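import Summits.CriticalPhenomena.SAWScalingLimit.Theorems.SAWLoopFugacityFlowAvoidanceLimitGreenConvergenceTendsto

/-!
# `stub_greenConvergence` (GC) from the printed Chelkak–Wan Corollary 3.3
— helper file of stub `stub_greenConvergence` (GC) of line `symplectic-fermion-anchor`
(crux `SAWLoopFugacityFlow.AvoidanceLimit`, stmt-CriticalPhenomena-10649; lead c2 GC-sandwich programme)

`stub_greenConvergence_of_killedGreen_tendsto` (registered sub-goal): the registered signature of the
line's stub `stub_greenConvergence` — interior convergence of the Green's function of the CONFINED
(edge-killed) walk, locally uniformly near two distinct interior points — follows from the printed theorem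
`Literature.Probability.LatticeModels.killedGreen_tendsto_of_kernelConvergence` (Chelkak–Wan 2021 Cor. 3.3,
site-killed walks on hole-free induced lattice domains; a NAMED FACT of the tree, taken here as an explicit
hypothesis) with constant `c = 2/π`, by the sequential form `tendsto_greenEntry_confined_of_killedGreen_tendsto`
(the inner/outer hole-free lattice sandwich) and a diagonal argument (bad pairs at scales `1/(k+1)`, a
strictly decreasing subsequence of meshes, interpolation by `nearestSite`).

Consequence for the line: its stub GC is now EXACTLY "Chelkak–Wan Cor. 3.3 as printed" — the `(V, E_int)`
(edge-killed) extension of the print that the stub's docstring recorded as missing is not needed.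

Sources: [ChelkakWan2021] Cor. 3.3 (§3.1); [ChelkakSmirnov2011] Thm. 3.9. No definitions; nothing from the
literature is asserted (the printed theorem is a hypothesis).
-/

noncomputable section

open scoped BigOperators Topology Pointwise
open Filter Finset
open Literature.Probability.RandomPlanarGeometry Literature.Probability.LatticeModels

namespace Summit.CriticalPhenomena.SAWScalingLimit.Theorems.AvoidanceLimit.Anchor

/-! ## GC from the printed theorem -/

/-- **REDUCTION (registered sub-goal): `stub_greenConvergence` (GC) from the printed Chelkak–Wan
Cor. 3.3 (`killedGreen_tendsto_of_kernelConvergence`).** The constant is `c = 2/π`. If the uniform local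
statement failed at some `(D, D', ψ, z*, y*, η)`, there would be meshes `δ_k → 0⁺` and lattice pairs
`(u_k, v_k)` with `δ_k u_k → z*`, `δ_k v_k → y*` along which the confined Green's function stays `η`-away
from `(2/π) G_ℍ(ψ⁻¹z*, ψ⁻¹y*)`; passing to a subsequence with `δ_k` strictly decreasing and interpolating it
by a function of the mesh (`nearestSite` elsewhere) contradicts
`tendsto_greenEntry_confined_of_killedGreen_tendsto`. [cite: ChelkakWan2021, Corollary 3.3 (§3.1)] -/
theorem stub_greenConvergence_of_killedGreen_tendsto :
    killedGreen_tendsto_of_kernelConvergence →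
    ∃ c : ℝ, 0 < c ∧ ∀ (D D' : JordanDomain), D'.carrier ⊆ D.carrier →
      ∀ (ψ : ConformalEquiv UpperHalfPlane.upperHalfPlaneSet D'.carrier),
      ∀ zs ys : ℂ, zs ∈ D'.carrier → ys ∈ D'.carrier → zs ≠ ys →
      ∀ η : ℝ, 0 < η → ∃ s : ℝ, 0 < s ∧ ∀ᶠ δ in 𝓝[>] (0 : ℝ), ∀ u v : Site 2,
        dist (meshPoint δ u) zs < s → dist (meshPoint δ v) ys < s →
        |greenEntry (confinedGraph D.carrier D'.carrier δ) (meshDomainFinset D.carrier δ) u v -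
          c * Real.log (‖ψ.symm zs - (starRingEnd ℂ) (ψ.symm ys)‖ / ‖ψ.symm zs - ψ.symm ys‖)| ≤ η := by
  intro hCW
  refine ⟨2 / Real.pi, by positivity, ?_⟩
  intro D D' hsub ψ zs ys hzs hys hne η hη
  classical
  set L : ℝ := 2 / Real.pi *
    Real.log (‖ψ.symm zs - (starRingEnd ℂ) (ψ.symm ys)‖ / ‖ψ.symm zs - ψ.symm ys‖) with hL
  set G : ℝ → Site 2 → Site 2 → ℝ := fun δ u v =>
    greenEntry (confinedGraph D.carrier D'.carrier δ) (meshDomainFinset D.carrier δ) u v with hG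
  by_contra hcon
  -- (1) bad meshes and pairs at every scale `1/(k+1)`
  have hex : ∀ k : ℕ, ∃ δ : ℝ, 0 < δ ∧ δ < 1 / ((k : ℝ) + 1) ∧ ∃ u v : Site 2,
      dist (meshPoint δ u) zs < 1 / ((k : ℝ) + 1) ∧ dist (meshPoint δ v) ys < 1 / ((k : ℝ) + 1) ∧
      η < |G δ u v - L| := by
    intro k
    have hk : (0 : ℝ) < 1 / ((k : ℝ) + 1) := Nat.one_div_pos_of_nat
    by_contra hk'
    push Not at hk'
    refine hcon ⟨1 / ((k : ℝ) + 1), hk, ?_⟩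
    filter_upwards [Ioo_mem_nhdsGT hk] with δ hδ u v hu hv
    exact hk' δ hδ.1 hδ.2 u v hu hv
  choose δs hδs_pos hδs_lt us vs hus hvs hbad using hex
  -- (2) a strictly decreasing subsequence of the meshes
  have hw : Tendsto (fun k => 1 / δs k) atTop atTop := by
    refine tendsto_atTop_mono (fun k => ?_) tendsto_natCast_atTop_atTop
    have h1 := hδs_lt k
    rw [lt_div_iff₀ (by positivity)] at h1
    rw [le_div_iff₀ (hδs_pos k)]
    nlinarith [hδs_pos k]
  obtain ⟨φ, hφ, hφw⟩ := strictMono_subseq_of_tendsto_atTop hw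
  set e : ℕ → ℝ := fun k => δs (φ k) with he
  have he_pos : ∀ k, 0 < e k := fun k => hδs_pos (φ k)
  have he_anti : StrictAnti e := fun i j hij =>
    (one_div_lt_one_div (hδs_pos (φ i)) (hδs_pos (φ j))).1 (hφw hij)
  have he_inj : Function.Injective e := he_anti.injective
  have he_le : ∀ k, e k < 1 / ((k : ℝ) + 1) := fun k =>
    (hδs_lt (φ k)).trans_le (one_div_le_one_div_of_le (Nat.cast_add_one_pos k)
      (by exact_mod_cast Nat.succ_le_succ (hφ.id_le k)))
  have he_tendsto : Tendsto e atTop (𝓝[>] (0 : ℝ)) :=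
    tendsto_nhdsWithin_iff.2 ⟨squeeze_zero (fun k => (he_pos k).le) (fun k => (he_le k).le)
      tendsto_one_div_add_atTop_nhds_zero_nat, Eventually.of_forall he_pos⟩
  -- (3) interpolate the bad pairs by functions of the mesh
  set uδ : ℝ → Site 2 := fun δ =>
    if h : ∃ k, e k = δ then us (φ (Classical.choose h)) else nearestSite δ zs with huδ
  set vδ : ℝ → Site 2 := fun δ =>
    if h : ∃ k, e k = δ then vs (φ (Classical.choose h)) else nearestSite δ ys with hvδ
  have hchoose : ∀ k (h : ∃ j, e j = e k), Classical.choose h = k := fun k h =>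
    he_inj (Classical.choose_spec h)
  have huδ_e : ∀ k, uδ (e k) = us (φ k) := fun k => by
    have h : ∃ j, e j = e k := ⟨k, rfl⟩
    simp only [huδ, dif_pos h, hchoose k h]
  have hvδ_e : ∀ k, vδ (e k) = vs (φ k) := fun k => by
    have h : ∃ j, e j = e k := ⟨k, rfl⟩
    simp only [hvδ, dif_pos h, hchoose k h]
  -- the interpolations converge to `zs`, `ys`
  have key : ∀ (w : ℂ) (ws : ℕ → Site 2) (wδ : ℝ → Site 2),
      (∀ k, dist (meshPoint (δs k) (ws k)) w < 1 / ((k : ℝ) + 1)) →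
      (∀ k, wδ (e k) = ws (φ k)) → (∀ δ, (¬ ∃ k, e k = δ) → wδ δ = nearestSite δ w) →
      Tendsto (fun δ : ℝ => meshPoint δ (wδ δ)) (𝓝[>] 0) (𝓝 w) := by
    intro w ws wδ hws hwe hwn
    rw [Metric.tendsto_nhds]
    intro ε hε
    obtain ⟨K, hK⟩ := exists_nat_one_div_lt hε
    filter_upwards [Ioo_mem_nhdsGT (lt_min hε (he_pos K))] with δ hδ
    by_cases h : ∃ k, e k = δ
    · obtain ⟨k, rfl⟩ := h
      rw [hwe k]
      have hkK : K < k := (StrictAnti.lt_iff_gt he_anti).1 (lt_min_iff.1 hδ.2).2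
      have hKk : ((K : ℝ) + 1) ≤ (φ k : ℝ) + 1 := by
        exact_mod_cast Nat.succ_le_succ ((hφ.id_le K).trans (hφ.monotone hkK.le))
      calc dist (meshPoint (e k) (ws (φ k))) w < 1 / ((φ k : ℝ) + 1) := hws (φ k)
        _ ≤ 1 / ((K : ℝ) + 1) := one_div_le_one_div_of_le (Nat.cast_add_one_pos K) hKk
        _ < ε := hK
    · rw [hwn δ h]
      exact (dist_meshPoint_nearestSite_le hδ.1 w).trans_lt ((lt_min_iff.1 hδ.2).1)
  have hu : Tendsto (fun δ : ℝ => meshPoint δ (uδ δ)) (𝓝[>] 0) (𝓝 zs) :=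
    key zs us uδ hus huδ_e fun δ h => by simp only [huδ, dif_neg h]
  have hv : Tendsto (fun δ : ℝ => meshPoint δ (vδ δ)) (𝓝[>] 0) (𝓝 ys) :=
    key ys vs vδ hvs hvδ_e fun δ h => by simp only [hvδ, dif_neg h]
  -- (4) the limit theorem along the interpolation, read on the subsequence
  have hlim := tendsto_greenEntry_confined_of_killedGreen_tendsto hCW D D' hsub ψ zs ys hzs hys hne uδ vδ hu hv
  have hcomp := hlim.comp he_tendsto
  rw [Metric.tendsto_nhds] at hcomp
  obtain ⟨k, hk⟩ := (hcomp η hη).exists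
  rw [Function.comp_apply, huδ_e k, hvδ_e k, Real.dist_eq] at hk
  exact absurd hk (not_lt.2 (hbad (φ k)).le)

end Summit.CriticalPhenomena.SAWScalingLimit.Theorems.AvoidanceLimit.Anchor

end
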